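import Literature.AlgebraicGeometry.Motives.Cycles
import Mathlib.AlgebraicGeometry.IdealSheaf.Subscheme
import Mathlib.AlgebraicGeometry.Noetherian
import HarnessLib

/-!
# The closed subvariety with a given generic point

For a point `x` of a scheme `X`, the closed subset `closure {x}` with its **reduced induced closed
subscheme structure** is an integral closed subscheme of `X` with generic point `x`: the subvariety
`V = closure {x}` that the point `x` stands for in an algebraic cycle `Σ n_x [closure {x}]`
(Fulton, *Intersection Theory*, §1.2–1.3; Stacks 02QQ; Mathlib's `AlgebraicCycle X ℤ` is a function
on points). This file packages it as a `Literature.AlgebraicGeometry.Motives.ClosedSubvariety`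
(prelude `Cycles`: an integral scheme with a closed immersion into `X`), so that principal divisors
`[div φ]` of rational functions `φ ∈ K(V)` (`ClosedSubvariety.divFun`, the generators of `Rat_d X`)
can be formed on the subvariety through any point — in particular on the irreducible components
`V_η = closure {η}` of the inverse image `f⁻¹(W)` of a subvariety under a flat morphism, as needed
for Fulton's Theorem 1.7 (`f^*[div φ] = Σ m_η [div φ_η]`).

## Main definitions and results

* `ClosedSubvariety.ofPoint X x`: `closure {x}` with the reduced induced structure — the subscheme of
  Mathlib's vanishing ideal sheaf `Scheme.IdealSheafData.vanishingIdeal (closure {x})` — as a closed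
  subvariety of `X` (integral: `isIntegral_subscheme_vanishingIdeal_closure`).
* `range_ofPoint_ι`, `genericPoint_ofPoint`, `dim_ofPoint`: its underlying set is `closure {x}`, its
  generic point is `x`, its dimension is `Order.height x`; `ofPointPt x h` is its point over a
  specialisation `x ⤳ z`.
* `ker_stalkMap_ofPoint_ι`: its local ring at the point over `z` is `𝒪_{X,z} / 𝔭_x`, where `𝔭_x` is the
  prime of `𝒪_{X,z}` defined by the generisation `x` (the contraction of `𝔪_x` along
  `𝒪_{X,z} → 𝒪_{X,x}`): the kernel of the surjection `𝒪_{X,z} → 𝒪_{V,z}` is `𝔭_x`.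
* `ClosedSubvariety.comp V i`: a closed subvariety of a closed subscheme `i : W ↪ X` as a closed
  subvariety of `X`; `divFun_comp_apply`: its principal divisors are those of `V` pushed along `i`.

## Design notes

Mathlib has the vanishing ideal sheaf and its subscheme (`IdealSheafData.vanishingIdeal`,
`IdealSheafData.subscheme`, `subschemeι`, `range_subschemeι`) and, for Noetherian schemes, the
*non-reduced* component structure `Scheme.irreducibleComponent`; it has no bundled "integral closed
subscheme with generic point `x`" (searched: `ofPoint`, `reducedInduced`, `closureSubscheme` —
nothing). Reducedness and integrality of `(vanishingIdeal Z).subscheme` are proved in the tree in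
`Literature/AlgebraicGeometry/Resolution/ResolutionOfCurves.lean` for arbitrary closed `Z`; the
special case needed here is re-derived in ten lines (`isIntegral_subscheme_vanishingIdeal_closure`)
to keep the cycle prelude independent of the resolution-of-singularities development.

## References

* W. Fulton, *Intersection Theory*, 2nd ed. (1998), §1.2 ("For any subvariety `V` … the local ring
  `𝒪_{V,X}`"), §1.3, §1.5, §1.7.
* The Stacks Project, Tag 02QQ (cycles), Tag 01J3 (reduced induced closed subscheme structure).
-/

universe u

open CategoryTheory AlgebraicGeometry Order TopologicalSpace Topology IsLocalRing

namespace Literature.AlgebraicGeometry.Motives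

open Scheme.IdealSheafData

variable {X : Scheme.{u}}

/-- The reduced closed subscheme of `X` supported on the closure of a point is integral: it is
reduced (its affine pieces are spectra of quotients by radical ideals) and irreducible (the closure
of a point is irreducible). [folklore] -/
theorem isIntegral_subscheme_vanishingIdeal_closure (x : X) :
    IsIntegral (vanishingIdeal (⟨closure {x}, isClosed_closure⟩ : Closeds X)).subscheme := by
  set Z : Closeds X := ⟨closure {x}, isClosed_closure⟩
  haveI : IrreducibleSpace (vanishingIdeal Z).subscheme := by
    have e : ((vanishingIdeal Z).support : Set X) = Z := coe_support_vanishingIdeal Z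
    have hZ : IsIrreducible ((vanishingIdeal Z).support : Set X) := by
      rw [e]
      exact isIrreducible_singleton.closure
    exact Subtype.irreducibleSpace hZ
  haveI : IsReduced (vanishingIdeal Z).subscheme := by
    haveI : ∀ U, IsReduced ((vanishingIdeal Z).subschemeCover.openCover.X U) := by
      intro (U : X.affineOpens)
      change IsReduced (Spec (.of (Γ(X, (U : X.Opens)) ⧸ (vanishingIdeal Z).ideal U)))
      haveI : _root_.IsReduced (Γ(X, (U : X.Opens)) ⧸ (vanishingIdeal Z).ideal U) := by
        rw [← Ideal.isRadical_iff_quotient_reduced, vanishingIdeal_ideal]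
        exact PrimeSpectrum.isRadical_vanishingIdeal _
      infer_instance
    exact IsReduced.of_openCover _ (vanishingIdeal Z).subschemeCover.openCover
  exact isIntegral_of_irreducibleSpace_of_isReduced _

namespace ClosedSubvariety

variable (X) in
/-- **The closed subvariety of `X` with generic point `x`**: the closed subset `closure {x}` with its
reduced induced closed subscheme structure (the subscheme of the vanishing ideal sheaf of
`closure {x}`, Mathlib `Scheme.IdealSheafData.vanishingIdeal`/`subscheme`), which is integral
(`isIntegral_subscheme_vanishingIdeal_closure`). This is the subvariety `V = \overline{\{x\}}` that a
point `x` "stands for" in a cycle `Σ n_x [\overline{\{x\}}]` (Fulton, *Intersection Theory*, §1.2–1.3: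
"a `k`-cycle is a finite formal sum `Σ nᵢ [Vᵢ]`, `Vᵢ` `k`-dimensional subvarieties"; Stacks 02QQ),
needed to write the flat pull-back of `[div φ]` as a sum of principal divisors on the components of
`f⁻¹(W)`. [folklore] -/
noncomputable def ofPoint (x : X) : ClosedSubvariety X where
  carrier := (vanishingIdeal (⟨closure {x}, isClosed_closure⟩ : Closeds X)).subscheme
  ι := (vanishingIdeal (⟨closure {x}, isClosed_closure⟩ : Closeds X)).subschemeι
  isIntegral := isIntegral_subscheme_vanishingIdeal_closure x

variable (x : X)

/-- The inclusion of `ofPoint X x` is the identity on underlying points (by `rfl`). [folklore] -/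
@[simp]
lemma ofPoint_ι_apply (v : (ofPoint X x).carrier) : (ofPoint X x).ι v = v.1 := rfl

/-- The underlying set of `ofPoint X x` is `closure {x}`. [folklore] -/
lemma range_ofPoint_ι : Set.range (ofPoint X x).ι = closure {x} := by
  change Set.range (vanishingIdeal _).subschemeι = _
  rw [range_subschemeι, coe_support_vanishingIdeal]
  rfl

/-- A point of `ofPoint X x` is a specialisation of `x`. [folklore] -/
lemma specializes_ofPoint_ι (v : (ofPoint X x).carrier) : x ⤳ (ofPoint X x).ι v :=
  specializes_iff_mem_closure.mpr ((range_ofPoint_ι x).le ⟨v, rfl⟩)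

/-- A specialisation `z` of `x` defines a point of `ofPoint X x`. [folklore] -/
lemma mem_support_of_specializes {z : X} (h : x ⤳ z) :
    z ∈ (vanishingIdeal (⟨closure {x}, isClosed_closure⟩ : Closeds X)).support := by
  rw [← SetLike.mem_coe, coe_support_vanishingIdeal]
  exact h.mem_closure

/-- The point of `ofPoint X x` lying over a specialisation `z` of `x`. [folklore] -/
noncomputable def ofPointPt {z : X} (h : x ⤳ z) : (ofPoint X x).carrier :=
  ⟨z, mem_support_of_specializes x h⟩

/-- `ofPointPt x h` lies over `z` (by `rfl`). [folklore] -/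
@[simp]
lemma ofPoint_ι_ofPointPt {z : X} (h : x ⤳ z) : (ofPoint X x).ι (ofPointPt x h) = z := rfl

/-- The generic point of `ofPoint X x` is `x`: the inclusion maps the generic point of the integral
scheme `ofPoint X x` to a generic point of `closure {x}`, and generic points are unique (`T₀`).
[folklore] -/
@[simp]
lemma genericPoint_ofPoint : (ofPoint X x).genericPoint = x := by
  have h1 : IsGenericPoint ((ofPoint X x).ι (_root_.genericPoint (ofPoint X x).carrier))
      (closure {x}) := by
    have h := (genericPoint_spec (ofPoint X x).carrier).image (ofPoint X x).ι.continuous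
    rwa [Set.image_univ, range_ofPoint_ι, closure_closure] at h
  exact h1.eq isGenericPoint_closure

/-- The dimension of `ofPoint X x` is `dim closure {x} = Order.height x`. [folklore] -/
@[simp]
lemma dim_ofPoint : (ofPoint X x).dim = height x := by
  rw [dim, genericPoint_ofPoint]

/-- `ofPoint X x` is locally Noetherian when `X` is (a closed subscheme). [folklore] -/
instance isLocallyNoetherian_ofPoint [IsLocallyNoetherian X] :
    IsLocallyNoetherian (ofPoint X x).carrier :=
  LocallyOfFiniteType.isLocallyNoetherian (ofPoint X x).ι

/-- **Local rings of the reduced closed subscheme `\overline{\{x\}}`.** For a specialisation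
`x ⤳ z`, the (surjective) stalk map `𝒪_{X,z} → 𝒪_{V,z}` of `V = ofPoint X x` at the point over `z`
has kernel the prime ideal of `𝒪_{X,z}` defined by the generisation `x`, i.e. the contraction of
`𝔪_x ⊂ 𝒪_{X,x}` along `𝒪_{X,z} → 𝒪_{X,x}`; thus `𝒪_{V,z} = 𝒪_{X,z}/𝔭_x`. (Test the kernel inside the
function field of the integral scheme `V`: `𝒪_{V,z} ↪ K(V)`, and `𝒪_{X,x} → 𝒪_{V,ξ} = K(V)` is a
surjection of a local ring onto a field, with kernel `𝔪_x`.) [folklore] -/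
theorem ker_stalkMap_ofPoint_ι (v : (ofPoint X x).carrier) :
    RingHom.ker ((ofPoint X x).ι.stalkMap v).hom =
      (maximalIdeal (X.presheaf.stalk x)).comap
        (X.presheaf.stalkSpecializes (specializes_ofPoint_ι x v)).hom := by
  have hξ : (ofPoint X x).ι (_root_.genericPoint (ofPoint X x).carrier) = x := genericPoint_ofPoint x
  have hsv : _root_.genericPoint (ofPoint X x).carrier ⤳ v := genericPoint_specializes v
  -- the stalk map at the generic point: a surjection of `𝒪_{X, ι ξ}` onto the field `K(V)`
  have hker : RingHom.ker ((ofPoint X x).ι.stalkMap (_root_.genericPoint (ofPoint X x).carrier)).hom =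
      maximalIdeal (X.presheaf.stalk ((ofPoint X x).ι (_root_.genericPoint (ofPoint X x).carrier))) :=
    eq_maximalIdeal (RingHom.ker_isMaximal_of_surjective (K := (ofPoint X x).carrier.functionField) _
      ((ofPoint X x).ι.stalkMap_surjective _))
  -- naturality of stalk maps along the specialisation `ξ ⤳ v`
  have hnat := Scheme.Hom.stalkSpecializes_stalkMap (ofPoint X x).ι _ v hsv
  -- injectivity of `𝒪_{V,v} → K(V)`
  have hinj : Function.Injective ((ofPoint X x).carrier.presheaf.stalkSpecializes hsv).hom :=
    IsFractionRing.injective ((ofPoint X x).carrier.presheaf.stalk v) (ofPoint X x).carrier.functionField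
  -- `𝔪_x` is the contraction of `𝔪_{ι ξ}` along the isomorphism `𝒪_{X,x} ≅ 𝒪_{X, ι ξ}`
  have hspec : (ofPoint X x).ι (_root_.genericPoint (ofPoint X x).carrier) ⤳ x := hξ.symm ▸ specializes_refl x
  have hspec' : x ⤳ (ofPoint X x).ι (_root_.genericPoint (ofPoint X x).carrier) := hξ.symm ▸ specializes_refl x
  haveI : IsLocalHom (X.presheaf.stalkSpecializes hspec).hom := by
    have : IsIso (X.presheaf.stalkSpecializes hspec) :=
      ⟨X.presheaf.stalkSpecializes hspec', by simp [TopCat.Presheaf.stalkSpecializes_comp],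
        by simp [TopCat.Presheaf.stalkSpecializes_comp]⟩
    infer_instance
  have hmax := maximalIdeal_comap (X.presheaf.stalkSpecializes hspec).hom
  ext s
  rw [RingHom.mem_ker, Ideal.mem_comap, ← hinj.eq_iff, map_zero, ← CommRingCat.comp_apply, ← hnat,
    CommRingCat.comp_apply, ← X.presheaf.stalkSpecializes_comp hspec (specializes_ofPoint_ι x v),
    CommRingCat.comp_apply, ← RingHom.mem_ker, hker, ← hmax, Ideal.mem_comap]

/-! ### Pushing a closed subvariety forward along a closed immersion -/

/-- A closed subvariety `V ↪ W` of a closed subscheme `i : W ↪ X` is a closed subvariety of `X`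
(same integral scheme, inclusion `V.ι ≫ i`). [folklore] -/
def comp {W : Scheme.{u}} (V : ClosedSubvariety W) (i : W ⟶ X) [IsClosedImmersion i] :
    ClosedSubvariety X where
  carrier := V.carrier
  ι := V.ι ≫ i

/-- The underlying scheme of `V.comp i` is that of `V` (by `rfl`). [folklore] -/
@[simp]
lemma comp_carrier {W : Scheme.{u}} (V : ClosedSubvariety W) (i : W ⟶ X) [IsClosedImmersion i] :
    (V.comp i).carrier = V.carrier := rfl

/-- The inclusion of `V.comp i` is `V.ι ≫ i` (by `rfl`). [folklore] -/
@[simp]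
lemma comp_ι {W : Scheme.{u}} (V : ClosedSubvariety W) (i : W ⟶ X) [IsClosedImmersion i] :
    (V.comp i).ι = V.ι ≫ i := rfl

/-- The generic point of `V.comp i` is the image of that of `V`. [folklore] -/
@[simp]
lemma genericPoint_comp {W : Scheme.{u}} (V : ClosedSubvariety W) (i : W ⟶ X)
    [IsClosedImmersion i] : (V.comp i).genericPoint = i V.genericPoint := rfl

/-- `(V.comp i).carrier = V.carrier` is locally Noetherian when `V.carrier` is. [folklore] -/
instance isLocallyNoetherian_comp_carrier {W : Scheme.{u}} (V : ClosedSubvariety W) (i : W ⟶ X)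
    [IsClosedImmersion i] [IsLocallyNoetherian V.carrier] : IsLocallyNoetherian (V.comp i).carrier :=
  ‹_›

/-- The principal divisor of `f` on `V.comp i` is that of `f` on `V`, pushed along `i`: at `i w` it
is `V.divFun f w`. [folklore] -/
lemma divFun_comp_apply {W : Scheme.{u}} (V : ClosedSubvariety W) (i : W ⟶ X)
    [IsClosedImmersion i] [IsLocallyNoetherian V.carrier] (f : V.carrier.functionField) (w : W) :
    (V.comp i).divFun f (i w) = V.divFun f w := by
  classical
  by_cases hw : ∃ v, V.ι v = w
  · obtain ⟨v, rfl⟩ := hw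
    rw [V.divFun_ι_base]
    exact (V.comp i).divFun_ι_base f v
  · rw [V.divFun_of_notMem_range f (fun ⟨v, hv⟩ ↦ hw ⟨v, hv⟩), divFun_of_notMem_range]
    rintro ⟨v, hv⟩
    exact hw ⟨v, i.isClosedEmbedding.injective hv⟩

/-- The principal divisor of `f` on `V.comp i` vanishes off the image of `i`. [folklore] -/
lemma divFun_comp_of_notMem_range {W : Scheme.{u}} (V : ClosedSubvariety W) (i : W ⟶ X)
    [IsClosedImmersion i] [IsLocallyNoetherian V.carrier] (f : V.carrier.functionField) {x' : X}
    (hx' : x' ∉ Set.range i) : (V.comp i).divFun f x' = 0 :=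
  (V.comp i).divFun_of_notMem_range f fun ⟨v, hv⟩ ↦ hx' ⟨V.ι v, by
    rw [← hv]; exact (Scheme.Hom.comp_apply V.ι i v).symm⟩

end ClosedSubvariety

end Literature.AlgebraicGeometry.Motives
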